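import Summits.QuantumFields.YangMills.Theorems.BalabanUVNodesN21ThresholdMixture
import Literature.MathematicalPhysics.QuantumFieldTheory.Balaban1983to89.T4DressedR

/-!
# N21 (NE7c), strategy s3 «alternative currency», file 16 — (O-mix-4) TYPED: the ℝ-DENOMINATOR THRESHOLD SANDWICH, and (M1)-by-Fubini
# for ℝ-inserted slots with the loss displayed

Seat `pub-ymgap-dag-n21-e` (R141 (C) fan-out, node N21 = NE7c `T4IndicatorShell.ShellWeightBound`, strategy s3), g6.  Lane: `--kind proof
--supports stmt-QuantumFields-19912 --as helper` (K3‴ `SpineGivenEndpointR13`).  Count-neutral.  Companion of file 15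
(`…N21ThresholdMixtureTowerOps`, p500803), which LOCATED the one place where the mixture road meets the 𝐑-operation's own letters: the small-field
characteristic functions of the receiving term `Z″` on the fibre bond set `Z′`, INSIDE the (0.3) denominator `∫dV⌈_{Z′} ρ(Z″,V)`
([Balaban1989LargeFieldI] (0.3) p. 176; b01's `B15.BasicStep.normTerm s new old = new·∫⌈old ∕ ∫⌈new`).  Their multipliers make the normalised insert
`S`-dependent through `1 ∕ ∫⌈new_S`.  This file types the located input (O-mix-4) as ONE displayed letter and shows what it buys:

* §1 (b01 letters) the real fibre integral `∫⌈` is MONOTONE on bounded densities (`fibreIntegral_mono`), so a positive lower one propagates up.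
* §2 THE SANDWICH.  The small-field polarity is monotone in the threshold, so over a window the inserts are nested: `0 ≤ new_bot ≤ new_S ≤ new_top`.
  Then, pointwise in `V` and for every `old`,
  `D(V)⁻¹·normTerm(new_bot, old)(V) ≤ normTerm(new_S, old)(V) ≤ D(V)·normTerm(new_top, old)(V)`, **`D(V) := ∫⌈_{Z′} new_top ∕ ∫⌈_{Z′} new_bot`**
  — (O-mix-4) «ℝ-denominator threshold sensitivity» as a displayed letter (the ratio of the receiving term's fibre integrals at the top and bottom
  thresholds of the window; in print the ratio of a renormalised component's small-field partition functions at thresholds `θ` vs `(1−κ)θ` —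
  NODE O ∕ def-R ∕ N20 (NE7b) species if ever priced; NOT estimated here).
* §3 WHAT IT BUYS.  The (M1)-by-Fubini mechanism of the mixture road (lens Card 5 (4), 5a `thresholdMixture_shell_le`: for ANY law `μ`, the moving
  shell `{S(1−ρ) ≤ u < S}` has `μ ⊗ Leb|window`-mass `≤ θρ∕(1−ρ)·μ(univ)`) TOLERATES an `S`-DEPENDENT density dominated by `D·g` uniformly over the
  window: the shell integral is `≤ D·θρ∕(1−ρ)·∫g` (`setLIntegral_shell_le_of_dominated`; the fibre form `volume_restrict_shell_fibre_le` is 5a's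
  lemma at a Dirac law).  With §2's upper half (`f_S = normTerm(new_S, old) ≤ D·normTerm(new_top, old)`): (M1) for an ℝ-INSERTED slot on the mixture
  road holds against the TOP-threshold piece's mass at the price `D`.
* §4 GUARD.  On `T4DressedR`'s one-bond toy (counting measure on one `Bool` variable): the value of (0.3) at the SUM of two threshold vectors is `20`
  at `V ≡ true` while the two values sum to `22` (`quotient_not_additive`) — the quotient is not additive, hence (being homogeneous of degree one)
  does not commute with threshold mixtures pointwise, the species file 15 located —, yet both sides integrate to `30` (`lintegral_quotient_additive`,
  the (0.4)∕spectator face).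

HONEST FRAMING.  NE7c is NOT PRINTED and NOT PROVED.  Kernel bookkeeping (monotonicity of `lmarginal`, two real inequalities, one Tonelli bound)
over b01 ∕ 5a letters; `D` is DISPLAYED, never estimated; the mixture (a convex combination of print's SHARP procedure over admissible threshold
vectors) is design, NOT print verbatim; (M1) for print's deterministic sharp procedure untouched; nothing of Bałaban's asserted; N21 NOT
discharged; count-neutral; one finite four-torus programme at fixed `ε`; NOT continuum ∕ ℝ⁴ ∕ OS ∕ mass gap ∕ Clay.

CITATION HEADER (lean-in-tree rule 2026-08-18).  BY NAME: b01 `B15.BasicStep.fibreIntegral` ∕ `normTerm` ∕ `Rop03` ∕ `lmarginal_ofReal_le`; `T4DressedR.cnt` ∕ `fibW` ∕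
`ppW` ∕ `lintegral_cnt` ∕ `lmarginal_fibW` (the one-bond toy of its §3)
([Balaban1989LargeFieldI] (0.3)–(0.4) p. 176, typed there with locators); 5a `thresholdMixture_shell_le` (lens `Sketch-nearmiss-g2` §A, landed
p466893).  Context only (SHAPE): [Balaban1989LargeFieldI] (0.3) p. 176 — *"(ℝρ)(V) = Σ_Z ρ(Z″,V) ∫dV⌈_{Z′}ρ(Z,V) ∕ ∫dV⌈_{Z′}ρ(Z″,V)"*.

WHAT IS PROVED ([folklore]).  §1 `fibreIntegral_mono` · `fibreIntegral_pos_of_le`; §2 ★ `normTerm_le_ratio_mul_normTerm` · `ratio_mul_normTerm_le_normTerm`;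
§3 `volume_restrict_shell_fibre_le` · ★ `setLIntegral_shell_le_of_dominated`; §4 (guard) `toy_div` · `toy_rop03_values` · ★ `quotient_not_additive` ·
`lintegral_quotient_additive`.
-/

set_option autoImplicit false

noncomputable section

open MeasureTheory Set
open scoped BigOperators ENNReal

namespace Summit.QuantumFields.YangMills.Theorems.N21ThresholdMixtureTowerOpsDenominator

open Literature.MathematicalPhysics.QuantumFieldTheory.Balaban1983to89
open Literature.MathematicalPhysics.QuantumFieldTheory.Balaban1983to89.B15.BasicStep (fibreIntegral normTerm lmarginal_ofReal_le)
open Summit.QuantumFields.YangMills.Theorems.N21ThresholdMixture (thresholdMixture_shell_le)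

/-! ## §1 The real fibre integral is monotone on bounded densities -/

section Fibre

variable {P : Params} {j : ℕ} {G : Type*} [GaugeGroup G] [MeasurableSpace G] [HaarData G]
variable [DecidableEq (PBond P j)]

/-- `∫⌈_s f ≤ ∫⌈_s g` for `f ≤ g ≤ C` pointwise (no measurability needed: `lmarginal` is monotone; the bound keeps the upper fibre integral finite
so that `toReal` is monotone). [folklore] -/
theorem fibreIntegral_mono (s : Finset (PBond P j)) {f g : Density P j G} (hfg : ∀ V, f V ≤ g V) {C : ℝ} (hgC : ∀ V, g V ≤ C)
    (V : GaugeField P j G) : fibreIntegral s f V ≤ fibreIntegral s g V := by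
  unfold fibreIntegral
  exact ENNReal.toReal_mono (ne_top_of_le_ne_top ENNReal.ofReal_ne_top (lmarginal_ofReal_le s hgC V))
    (lmarginal_mono (fun U => ENNReal.ofReal_le_ofReal (hfg U)) V)

/-- A positive fibre integral propagates up a pointwise inequality of bounded densities. [folklore] -/
theorem fibreIntegral_pos_of_le (s : Finset (PBond P j)) {f g : Density P j G} (hfg : ∀ V, f V ≤ g V) {C : ℝ} (hgC : ∀ V, g V ≤ C)
    (V : GaugeField P j G) (hpos : 0 < fibreIntegral s f V) : 0 < fibreIntegral s g V :=
  lt_of_lt_of_le hpos (fibreIntegral_mono s hfg hgC V)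

/-! ## §2 The ℝ-denominator threshold sandwich — (O-mix-4) as the displayed letter `D = ∫⌈new_top ∕ ∫⌈new_bot` -/

/-- ★ **UPPER HALF.**  Nested inserts `0 ≤ new_bot ≤ new_S ≤ new_top ≤ C` (the small-field polarity is monotone in the threshold) with a
positive bottom fibre integral, any `old`: `normTerm s new_S old V ≤ (∫⌈new_top V ∕ ∫⌈new_bot V)·normTerm s new_top old V` — the `S`-dependent
normalised insert is dominated, UNIFORMLY over the window, by the top-threshold one times (O-mix-4). [cite: Balaban1989LargeFieldI, (0.3) p.176 (bookkeeping)] -/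
theorem normTerm_le_ratio_mul_normTerm (s : Finset (PBond P j)) {newBot newS newTop : Density P j G} (old : Density P j G)
    (hb0 : ∀ V, 0 ≤ newBot V) (hbS : ∀ V, newBot V ≤ newS V) (hSt : ∀ V, newS V ≤ newTop V) {C : ℝ}
    (htC : ∀ V, newTop V ≤ C) (hpos : ∀ V, 0 < fibreIntegral s newBot V) (V : GaugeField P j G) :
    normTerm s newS old V
      ≤ (fibreIntegral s newTop V / fibreIntegral s newBot V) * normTerm s newTop old V := by
  have hSC : ∀ V, newS V ≤ C := fun V => le_trans (hSt V) (htC V)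
  have hbotS : fibreIntegral s newBot V ≤ fibreIntegral s newS V := fibreIntegral_mono s hbS hSC V
  have hStop : fibreIntegral s newS V ≤ fibreIntegral s newTop V := fibreIntegral_mono s hSt htC V
  have hbot_pos : 0 < fibreIntegral s newBot V := hpos V
  have hS_pos : 0 < fibreIntegral s newS V := lt_of_lt_of_le hbot_pos hbotS
  have htop_pos : 0 < fibreIntegral s newTop V := lt_of_lt_of_le hS_pos hStop
  have ho0 : 0 ≤ fibreIntegral s old V := ENNReal.toReal_nonneg
  have ht0 : 0 ≤ newTop V := le_trans (hb0 V) (le_trans (hbS V) (hSt V))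
  unfold normTerm
  rw [show fibreIntegral s newTop V / fibreIntegral s newBot V * (newTop V * (fibreIntegral s old V / fibreIntegral s newTop V))
      = newTop V * (fibreIntegral s old V / fibreIntegral s newBot V) by
    field_simp]
  exact mul_le_mul (hSt V) (div_le_div_of_nonneg_left ho0 hbot_pos hbotS) (div_nonneg ho0 hS_pos.le) ht0

/-- **LOWER HALF.**  Same nesting: `(∫⌈new_bot V ∕ ∫⌈new_top V)·normTerm s new_bot old V ≤ normTerm s new_S old V`.
[cite: Balaban1989LargeFieldI, (0.3) p.176 (bookkeeping)] -/
theorem ratio_mul_normTerm_le_normTerm (s : Finset (PBond P j)) {newBot newS newTop : Density P j G} (old : Density P j G)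
    (hb0 : ∀ V, 0 ≤ newBot V) (hbS : ∀ V, newBot V ≤ newS V) (hSt : ∀ V, newS V ≤ newTop V) {C : ℝ}
    (htC : ∀ V, newTop V ≤ C) (hpos : ∀ V, 0 < fibreIntegral s newBot V) (V : GaugeField P j G) :
    (fibreIntegral s newBot V / fibreIntegral s newTop V) * normTerm s newBot old V
      ≤ normTerm s newS old V := by
  have hSC : ∀ V, newS V ≤ C := fun V => le_trans (hSt V) (htC V)
  have hbotS : fibreIntegral s newBot V ≤ fibreIntegral s newS V := fibreIntegral_mono s hbS hSC V
  have hStop : fibreIntegral s newS V ≤ fibreIntegral s newTop V := fibreIntegral_mono s hSt htC V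
  have hbot_pos : 0 < fibreIntegral s newBot V := hpos V
  have hS_pos : 0 < fibreIntegral s newS V := lt_of_lt_of_le hbot_pos hbotS
  have htop_pos : 0 < fibreIntegral s newTop V := lt_of_lt_of_le hS_pos hStop
  have ho0 : 0 ≤ fibreIntegral s old V := ENNReal.toReal_nonneg
  have hS0 : 0 ≤ newS V := le_trans (hb0 V) (hbS V)
  unfold normTerm
  rw [show fibreIntegral s newBot V / fibreIntegral s newTop V * (newBot V * (fibreIntegral s old V / fibreIntegral s newBot V))
      = newBot V * (fibreIntegral s old V / fibreIntegral s newTop V) by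
    field_simp]
  exact mul_le_mul (hbS V) (div_le_div_of_nonneg_left ho0 hS_pos hStop) (div_nonneg ho0 htop_pos.le) hS0

end Fibre

/-! ## §3 (M1)-by-Fubini tolerates an `S`-dependent density dominated over the window -/

section Shell

variable {X : Type*} [MeasurableSpace X]

/-- **THE FIBRE FORM OF 5a's MOVING-SHELL BOUND** (5a `thresholdMixture_shell_le` at the Dirac law `δ_v`): for every real `v`, every `θ`, `a` and
`0 ≤ ρ < 1`, `Leb|[a, θ] {S | S(1−ρ) ≤ v < S} ≤ θρ∕(1−ρ)`. [folklore] -/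
theorem volume_restrict_shell_fibre_le {θ ρ : ℝ} (a : ℝ) (hρ0 : 0 ≤ ρ) (hρ1 : ρ < 1) (v : ℝ) :
    volume.restrict (Icc a θ) {S : ℝ | S * (1 - ρ) ≤ v ∧ v < S} ≤ ENNReal.ofReal (θ * ρ / (1 - ρ)) := by
  have hS : MeasurableSet {p : ℝ × ℝ | p.2 * (1 - ρ) ≤ p.1 ∧ p.1 < p.2} :=
    (measurableSet_le (measurable_snd.mul_const _) measurable_fst).inter (measurableSet_lt measurable_fst measurable_snd)
  have h := thresholdMixture_shell_le (Measure.dirac v) (u := fun x : ℝ => x) measurable_id (θ := θ) (a := a) hρ0 hρ1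
  rw [Measure.dirac_prod, Measure.map_apply measurable_prodMk_left hS, measure_univ, mul_one] at h
  exact h

/-- ★ **(M1)-BY-FUBINI WITH A DOMINATED `S`-DEPENDENT DENSITY.**  Any measure `μ` on `X`, a statistic `u`, `0 ≤ ρ < 1`, a window `[a, θ]`, and an
`ℝ≥0∞`-valued density `F(x, S)` on `X × ℝ` dominated over the window by `D·g(x)`: the `μ ⊗ Leb|[a,θ]`-integral of `F` over the moving shell
`{S(1−ρ) ≤ u(x) < S}` is `≤ D·θρ∕(1−ρ)·∫g dμ` (Tonelli's inequality `lintegral_prod_le`, then the fibre bound).  On the mixture road `F(x,S)` = the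
ℝ-inserted piece at threshold `S` and `g` = the top-threshold piece, `D` = (O-mix-4) (§2): the wall (M1) stays crossed out for ℝ-inserted slots at the
price `D`, against the top-threshold mass. [folklore] -/
theorem setLIntegral_shell_le_of_dominated (μ : Measure X) {u : X → ℝ} (hu : Measurable u) {θ ρ : ℝ} (a : ℝ)
    (hρ0 : 0 ≤ ρ) (hρ1 : ρ < 1) (F : X × ℝ → ℝ≥0∞) {g : X → ℝ≥0∞} (hg : Measurable g) (D : ℝ≥0∞)
    (hFg : ∀ x, ∀ S ∈ Icc a θ, F (x, S) ≤ D * g x) :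
    ∫⁻ p in {p : X × ℝ | p.2 * (1 - ρ) ≤ u p.1 ∧ u p.1 < p.2}, F p ∂(μ.prod (volume.restrict (Icc a θ)))
      ≤ D * ENNReal.ofReal (θ * ρ / (1 - ρ)) * ∫⁻ x, g x ∂μ := by
  have hTm : MeasurableSet {p : X × ℝ | p.2 * (1 - ρ) ≤ u p.1 ∧ u p.1 < p.2} :=
    (measurableSet_le (measurable_snd.mul_const _) (hu.comp measurable_fst)).inter
      (measurableSet_lt (hu.comp measurable_fst) measurable_snd)
  -- the set integral is the integral of the indicator; Tonelli's inequality needs no measurability of `F`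
  rw [← lintegral_indicator hTm]
  refine le_trans (lintegral_prod_le _) ?_
  have hfib : ∀ x, ∫⁻ S, {p : X × ℝ | p.2 * (1 - ρ) ≤ u p.1 ∧ u p.1 < p.2}.indicator F (x, S) ∂(volume.restrict (Icc a θ))
      ≤ (D * ENNReal.ofReal (θ * ρ / (1 - ρ))) * g x := by
    intro x
    have hTx : MeasurableSet {S : ℝ | S * (1 - ρ) ≤ u x ∧ u x < S} :=
      (measurableSet_le (measurable_id.mul_const _) measurable_const).inter (measurableSet_lt measurable_const measurable_id)
    calc ∫⁻ S, {p : X × ℝ | p.2 * (1 - ρ) ≤ u p.1 ∧ u p.1 < p.2}.indicator F (x, S) ∂(volume.restrict (Icc a θ))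
        ≤ ∫⁻ S, {S : ℝ | S * (1 - ρ) ≤ u x ∧ u x < S}.indicator (fun _ => D * g x) S ∂(volume.restrict (Icc a θ)) := by
          refine lintegral_mono_ae ((ae_restrict_mem measurableSet_Icc).mono fun S hS => ?_)
          by_cases hmem : S * (1 - ρ) ≤ u x ∧ u x < S
          · rw [indicator_of_mem (by simpa using hmem), indicator_of_mem (by simpa using hmem)]
            exact hFg x S hS
          · simp [hmem]
      _ = D * g x * volume.restrict (Icc a θ) {S : ℝ | S * (1 - ρ) ≤ u x ∧ u x < S} := lintegral_indicator_const hTx _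
      _ ≤ D * g x * ENNReal.ofReal (θ * ρ / (1 - ρ)) := by
          gcongr
          exact volume_restrict_shell_fibre_le a hρ0 hρ1 (u x)
      _ = (D * ENNReal.ofReal (θ * ρ / (1 - ρ))) * g x := by ring
  calc ∫⁻ x, ∫⁻ S, {p : X × ℝ | p.2 * (1 - ρ) ≤ u p.1 ∧ u p.1 < p.2}.indicator F (x, S) ∂(volume.restrict (Icc a θ)) ∂μ
      ≤ ∫⁻ x, (D * ENNReal.ofReal (θ * ρ / (1 - ρ))) * g x ∂μ := lintegral_mono hfib
    _ = (D * ENNReal.ofReal (θ * ρ / (1 - ρ))) * ∫⁻ x, g x ∂μ := lintegral_const_mul _ hg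

end Shell

/-! ## §4 Guard: at the VALUE level the (0.3) quotient is NOT additive in the term vector — hence does not commute with threshold
mixtures pointwise — while its TOTAL integrals are; a two-point witness on `T4DressedR`'s one-bond toy (`cnt`, `fibW`, `ppW`) -/

section Witness

open Literature.MathematicalPhysics.QuantumFieldTheory.Balaban1983to89.B15.BasicStep (Rop03)
open Literature.MathematicalPhysics.QuantumFieldTheory.Balaban1983to89.T4DressedR (cnt fibW ppW lintegral_cnt lmarginal_fibW)

/-- Two exact divisions in `ℝ≥0∞` used by the toy. [folklore] -/
theorem toy_div : (12 : ℝ≥0∞) / 2 = 6 ∧ (12 : ℝ≥0∞) / 4 = 3 ∧ (24 : ℝ≥0∞) / 6 = 4 ∧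
    (2 : ℝ≥0∞) / 2 = 1 ∧ (4 : ℝ≥0∞) / 4 = 1 ∧ (6 : ℝ≥0∞) / 6 = 1 := by
  refine ⟨?_, ?_, ?_, ENNReal.div_self (by norm_num) (by simp), ENNReal.div_self (by norm_num) (by simp),
    ENNReal.div_self (by norm_num) (by simp)⟩
  · rw [eq_comm, ENNReal.eq_div_iff (by norm_num) (by simp)]; norm_num
  · rw [eq_comm, ENNReal.eq_div_iff (by norm_num) (by simp)]; norm_num
  · rw [eq_comm, ENNReal.eq_div_iff (by norm_num) (by simp)]; norm_num

/-- **THE TOY AT TWO THRESHOLDS.**  One two-valued bond with counting measure, two terms, both integrating out the bond (`fibW`) and taking their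
insert from the receiving term `false` (`ppW`); the renormalised term `true` is `old ≡ 6` at every threshold.  LOW threshold: the receiving term's
insert is `2·1[V = true]` (only `true` is small); HIGH threshold: `≡ 2` (everything small); their SUM (twice the ½–½ mixture): `2·1[V = true] + 2`.
Values of (0.3) at `V ≡ true`: low `14`, high `8`, sum-vector `20 ≠ 14 + 8`; totals: `14 + 0 + 8 + 8 = 30 = 20 + 10`. [folklore] -/
theorem toy_rop03_values :
    Rop03 cnt (fun (Z : Bool) (V : Unit → Bool) => cond Z (6 : ℝ≥0∞) (cond (V ()) 2 0)) ppW fibW (fun _ => true) = 14 ∧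
    Rop03 cnt (fun (Z : Bool) (V : Unit → Bool) => cond Z (6 : ℝ≥0∞) (cond (V ()) 2 0)) ppW fibW (fun _ => false) = 0 ∧
    Rop03 cnt (fun (Z : Bool) (_ : Unit → Bool) => cond Z (6 : ℝ≥0∞) 2) ppW fibW (fun _ => true) = 8 ∧
    Rop03 cnt (fun (Z : Bool) (_ : Unit → Bool) => cond Z (6 : ℝ≥0∞) 2) ppW fibW (fun _ => false) = 8 ∧
    Rop03 cnt (fun (Z : Bool) (V : Unit → Bool) => cond Z (6 : ℝ≥0∞) (cond (V ()) 2 0) + cond Z (6 : ℝ≥0∞) 2) ppW fibW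
        (fun _ => true) = 20 ∧
    Rop03 cnt (fun (Z : Bool) (V : Unit → Bool) => cond Z (6 : ℝ≥0∞) (cond (V ()) 2 0) + cond Z (6 : ℝ≥0∞) 2) ppW fibW
        (fun _ => false) = 10 := by
  obtain ⟨h12, h124, h246, h22, h44, h66⟩ := toy_div
  refine ⟨?_, ?_, ?_, ?_, ?_, ?_⟩ <;>
    simp only [Rop03, Fintype.sum_bool, ppW, lmarginal_fibW, Function.update_self, cond_true, cond_false] <;>
    norm_num <;> first
      | (rw [h12, h22]; norm_num)
      | (rw [h124, h44]; norm_num)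
      | (rw [h246, h66]; norm_num)

/-- ★ **WITNESS: THE QUOTIENT IS NOT ADDITIVE IN THE TERM VECTOR** (value level): (0.3) of the sum of the two threshold vectors at `V ≡ true`
is `20`, the sum of the two (0.3)'s is `22`.  Since (0.3) is homogeneous of degree one in the term vector, this is exactly its failure to commute
with the ½–½ threshold mixture pointwise — the species file 15 calls «(K-ii) FIRES at the typed 𝐑». [folklore] -/
theorem quotient_not_additive :
    Rop03 cnt (fun (Z : Bool) (V : Unit → Bool) => cond Z (6 : ℝ≥0∞) (cond (V ()) 2 0) + cond Z (6 : ℝ≥0∞) 2) ppW fibW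
        (fun _ => true)
      ≠ Rop03 cnt (fun (Z : Bool) (V : Unit → Bool) => cond Z (6 : ℝ≥0∞) (cond (V ()) 2 0)) ppW fibW (fun _ => true)
        + Rop03 cnt (fun (Z : Bool) (_ : Unit → Bool) => cond Z (6 : ℝ≥0∞) 2) ppW fibW (fun _ => true) := by
  obtain ⟨h1, -, h3, -, h5, -⟩ := toy_rop03_values
  rw [h1, h3, h5]
  norm_num

/-- **… WHILE ITS TOTAL INTEGRALS ARE ADDITIVE** ((0.4): both sides integrate to `Σ_Z ∫ piece Z`; here `30 = 30`) — the spectator face of file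
15 §2 on the toy. [folklore] -/
theorem lintegral_quotient_additive :
    ∫⁻ V, Rop03 cnt (fun (Z : Bool) (V : Unit → Bool) => cond Z (6 : ℝ≥0∞) (cond (V ()) 2 0) + cond Z (6 : ℝ≥0∞) 2) ppW fibW V
        ∂Measure.pi cnt
      = ∫⁻ V, (Rop03 cnt (fun (Z : Bool) (V : Unit → Bool) => cond Z (6 : ℝ≥0∞) (cond (V ()) 2 0)) ppW fibW V
          + Rop03 cnt (fun (Z : Bool) (_ : Unit → Bool) => cond Z (6 : ℝ≥0∞) 2) ppW fibW V) ∂Measure.pi cnt := by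
  obtain ⟨h1, h2, h3, h4, h5, h6⟩ := toy_rop03_values
  rw [lintegral_cnt _ (fun _ => false), lintegral_cnt _ (fun _ => false)]
  have hf : (Function.update (fun _ : Unit => false) () false) = fun _ => false := by
    funext u; cases u; simp
  have ht : (Function.update (fun _ : Unit => false) () true) = fun _ => true := by
    funext u; cases u; simp
  rw [hf, ht, h1, h2, h3, h4, h5, h6]
  norm_num

end Witness

end Summit.QuantumFields.YangMills.Theorems.N21ThresholdMixtureTowerOpsDenominator

end
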